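import Summits.ABC.ABC.Theorems.EisensteinQuarantine.Negative.EisensteinQuarantineFalseOfForcedPairDepthLaw
import Literature.NumberTheory.EllipticCurves.TakahashiDegreeFormula
import Literature.NumberTheory.Automorphic.ShimuraCurveRibetTakahashiSemistableManinProofs
import HarnessLib

/-!
# `EisensteinQuarantine` (stmt-ABC-15023, route ABC/DefiniteXi) is false under a 2-adic depth law for OPTIMAL
# MODULAR DEGREES — the Takahashi transfer that every census of this crux used, kernel-checked

Negative lemmas filed `--negative-modulo ForcedPairDegreeDepthLaw` by the lead (c3) of crux line `forced-pair-dlog`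
(2026-08-17).  The crux `Summit.ABC.ABC.Theses.DefiniteXi.EisensteinQuarantine`
(`sixPart ξ(E; N/N⁻, N⁻) ≤ C_ε N^ε · 𝓛`) is census-false AS FILED, and the tree holds the conditional kills
`ProthDepthFamily → ¬EQ` (p107816) and `ForcedPairDepthLaw → ¬EQ` (p134266), whose hypotheses are LOWER bounds on
the 2-part of the quarantined congruence number `ξ = brandtXi (N/ℓ) ℓ (a(E))` along a family of Legendre Frey
curves `E_(−ℓ, ℓ−1)`.  No census ever measured `ξ` beyond class number `h ≈ 12 300` (`N ≲ 1.5·10⁵`, custom Brandt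
engines); every row at larger conductor (kit j016666, j017919, j019719, j020814/j020843: `N` up to `1.4·10⁶`) measured
the OPTIMAL MODULAR DEGREE on `X₀(N)` (PARI `ellmoddegree` over the isogeny class) and moved it to `ξ` by
Takahashi 2001, Thm. 2.3: at a prime `r ∥ N` of a semistable optimal curve `W`, in every Brandt setup `S` of type
`(N/r, r)`, `δ · i = ξ_S · j` with `i · j = c_r(W) = ord_r Δ_min(W)` and `i ≥ 1`.  This file makes that transfer a
theorem of the tree and restates the two hypotheses on the DEGREE side:

* `ordProj_modularDegree_le_of_takahashi` — for every prime `p`: `ordProj[p] δ ≤ ordProj[p] c_r(W) · ordProj[p] ξ_S`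
  (pure arithmetic from the named fact `takahashi2001_thm_2_3`; `ξ_S ≠ 0` and `j ≠ 0` because `δ, i ≥ 1`).
* `pow_le_ordProj_brandtXi_of_degreeBound` — at a Legendre point `(a, b) = (−ℓ, ℓ−1)`, `ℓ` prime, `32 ∣ ℓ − 1`
  (conductor `N = rad(ℓ(ℓ−1))`, squarefree, by the tree's PROVED Serre normalisation), a bound
  `2^v · ordProj[2] c_ℓ(W) ≤ 2^c · ordProj[2] δ(P)` for every curve `W` with the `a`-sequence of `E` and every
  newform-minimal datum `P` of `W` at level `N` forces `2^v ≤ 2^c · ordProj[2] (brandtXi (N/ℓ) ℓ (a(E)))`.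
  Inputs: `takahashi2001_thm_2_3` (named fact, TRUE in print), `FreyModularity` (route item stmt-ABC-11340, TRUE in
  print: it supplies ONE datum of `E`, from which a newform-minimal datum of the class exists by well-ordering of `ℕ`),
  Carayol at squarefree LEVEL (tree theorem `IsNewformOf.level_eq_conductorNorm_of_squarefree_level`), setup
  existence `nonempty_xiSetup_freyCurve` and setup independence `Brandt.XiSetup.brandtXi_eq_xi` (tree theorems).
* `ForcedPairDegreeDepthLaw` / `ProthDegreeDepthFamily` — the degree-side twins of `ForcedPairDepthLaw` (p134266) and
  `ProthDepthFamily` (p107816): `v₂(δ_opt) − v₂(c_ℓ(W_opt)) ≥ v₂(q−1) − c` at forced pairs, resp. `≥ s − c` along a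
  polynomially sparse Proth family.  These are statements about modular degrees of strong Weil curves over `ℚ` —
  checkable row by row against PARI / the Cremona–Watkins and LMFDB degree tables, with no quaternion arithmetic.
* `forcedPairDepthLaw_of_degreeDepthLaw`, `prothDepthFamily_of_degreeDepthFamily` and the two refutations
  `EisensteinQuarantine_false_of_ForcedPairDegreeDepthLaw`, `EisensteinQuarantine_false_of_ProthDegreeDepthFamily`.

Nothing here is a lower bound on `ξ` by itself: the named fact `takahashi2001_thm_2_3` carries the eigen-line
(`xi_ne_zero`), consistent with `frequently_isLine_of_forcedPairDepthLaw` (p134266: every refutation of this crux passes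
through Jacquet–Langlands + multiplicity one).

## References

* [Takahashi2001] S. Takahashi, Degrees of parametrizations of elliptic curves by Shimura curves, J. Number Theory 90
  (2001), §2 p. 78, Thm. 2.3 (p. 79).
* [Mazur1977] B. Mazur, Modular curves and the Eisenstein ideal, Publ. Math. IHÉS 47 (1977), II.16.6, II.18.10.
* [AtkinLehner1970] A. O. L. Atkin, J. Lehner, Hecke operators on `Γ₀(m)`, Math. Ann. 185 (1970), Thm. 3.
* [PollackWeston2011] R. Pollack, T. Weston, Compos. Math. 147 (2011), §2.1.
-/

-- `Summit.<Summit>.<Problem>`: for the single-conjunct summit `ABC` the duplicate `ABC.ABC` is mandated.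
set_option linter.dupNamespace false

noncomputable section

open scoped BigOperators
open Literature.NumberTheory.Automorphic Literature.NumberTheory.EllipticCurves
open Literature.NumberTheory.EllipticCurves.ModularForms

namespace Summit.ABC.ABC.Theorems.EisensteinQuarantine.Negative

/-! ## The Takahashi transfer: `p`-parts of the optimal degree against `p`-parts of `ξ` -/

/-- **`ordProj[p] δ ≤ ordProj[p] c_r · ordProj[p] ξ_S` (Takahashi 2001, Thm. 2.3, valuation form).**  In the
situation of the named fact `takahashi2001_thm_2_3` — `W/ℚ` elliptic of squarefree conductor `M r`, `r` prime, `P` a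
datum at level `M r` of minimal degree among all data with the same newform (the optimal quotient), `S` a Brandt setup
of type `(M, r)` — one has `δ i = ξ_S j`, `i j = c_r := ord_r Δ_min(W)`, `i ≥ 1`; as `δ ≥ 1` this forces `ξ_S ≠ 0`,
`j ≠ 0`, and for every `p`: `ordProj[p] δ · ordProj[p] i = ordProj[p] ξ_S · ordProj[p] j` with `ordProj[p] j ∣ ordProj[p] c_r`,
whence the claim. [cite: Takahashi2001, Thm. 2.3 (p. 79)] -/
theorem ordProj_modularDegree_le_of_takahashi (hT : takahashi2001_thm_2_3) (p : ℕ)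
    (W : WeierstrassCurve ℚ) [W.IsElliptic] (M r : ℕ) [NeZero (M * r)]
    (hr : r.Prime) (hsq : Squarefree (M * r)) (hN : W.conductorNorm ℤ = M * r)
    (P : ModularParametrizationData W (M * r))
    (hmin : ∀ (W' : WeierstrassCurve ℚ) [W'.IsElliptic] (P' : ModularParametrizationData W' (M * r)),
      P'.f = P.f → P.modularDegree ≤ P'.modularDegree)
    (S : Brandt.XiSetup M r) :
    ordProj[p] P.modularDegree ≤
      ordProj[p] ((W.minimalDiscriminantNorm ℤ).factorization r) *
        ordProj[p] (S.xi fun n => W.LFunction n) := by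
  obtain ⟨i, j, hi, hij, -, hδ⟩ := hT W M r hr hsq hN P hmin S
  have hδ0 : P.modularDegree ≠ 0 := P.deg_pos.ne'
  have hδi : P.modularDegree * i ≠ 0 := Nat.mul_ne_zero hδ0 hi.ne'
  have hj0 : j ≠ 0 := by
    rintro rfl
    rw [mul_zero] at hδ
    exact hδi hδ
  have hξ0 : S.xi (fun n => W.LFunction n) ≠ 0 := by
    intro h0
    rw [h0, zero_mul] at hδ
    exact hδi hδ
  have hc0 : (W.minimalDiscriminantNorm ℤ).factorization r ≠ 0 := by
    rw [← hij]; exact Nat.mul_ne_zero hi.ne' hj0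
  have h1 : ordProj[p] P.modularDegree * ordProj[p] i =
      ordProj[p] (S.xi fun n => W.LFunction n) * ordProj[p] j := by
    rw [← Nat.ordProj_mul p hδ0 hi.ne', ← Nat.ordProj_mul p hξ0 hj0, hδ]
  have hjc : ordProj[p] j ≤ ordProj[p] ((W.minimalDiscriminantNorm ℤ).factorization r) :=
    Nat.le_of_dvd (Nat.ordProj_pos _ _)
      (Nat.ordProj_dvd_ordProj_of_dvd hc0 (hij ▸ Dvd.intro_left i rfl) p)
  calc ordProj[p] P.modularDegree
      ≤ ordProj[p] P.modularDegree * ordProj[p] i := Nat.le_mul_of_pos_right _ (Nat.ordProj_pos _ _)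
    _ = ordProj[p] (S.xi fun n => W.LFunction n) * ordProj[p] j := h1
    _ ≤ ordProj[p] (S.xi fun n => W.LFunction n) *
          ordProj[p] ((W.minimalDiscriminantNorm ℤ).factorization r) := Nat.mul_le_mul_left _ hjc
    _ = _ := mul_comm _ _

/-! ## The transfer at a Legendre point `(a, b) = (−ℓ, ℓ − 1)` -/

/-- **Degree bound ⟹ `ξ` bound at a Legendre–Proth point.**  Let `ℓ` be a prime with `32 ∣ ℓ − 1`,
`E = E_(−ℓ, ℓ−1) = freyCurve (−ℓ) (ℓ−1)` (the triple `1 + (ℓ−1) = ℓ`, Serre-normalised: conductor `N = rad(ℓ(ℓ−1))`,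
squarefree, `ℓ ∣ N`).  Granted `takahashi2001_thm_2_3` and `FreyModularity`: if every elliptic `W/ℚ` with the
`a`-sequence of `E` and every datum `P` of `W` at level `N` that is degree-minimal in its newform class satisfy
`2^v · ordProj[2] c_ℓ(W) ≤ 2^c · ordProj[2] δ(P)`, then `2^v ≤ 2^c · ordProj[2] (brandtXi (N/ℓ) ℓ (a(E)))`.
Proof: `FreyModularity` gives a datum `P₀` of `E` at level `N = N/ℓ · ℓ`; a degree-minimal datum `P` of some `W` with
`P.f = P₀.f` exists by well-ordering of `ℕ`; `W` has the `a`-sequence of `E` (`IsNewformOf`) and conductor `N`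
(Carayol at the squarefree level `N`, `IsNewformOf.level_eq_conductorNorm_of_squarefree_level`); a setup `S` of type
`(N/ℓ, ℓ)` exists (`nonempty_xiSetup_freyCurve`) and computes `brandtXi` (`Brandt.XiSetup.brandtXi_eq_xi`); then
`ordProj_modularDegree_le_of_takahashi` at `p = 2` and the hypothesis give
`2^v · C ≤ 2^c · C · ordProj[2] ξ` with `C = ordProj[2] c_ℓ(W) ≥ 1`. [cite: Takahashi2001, Thm. 2.3 (p. 79)] -/
theorem pow_le_ordProj_brandtXi_of_degreeBound (hT : takahashi2001_thm_2_3)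
    (hMod : Summit.ABC.ABC.Theses.DefiniteXi.FreyModularity) {ℓ : ℕ} (hℓ : ℓ.Prime) (h32 : 32 ∣ ℓ - 1)
    {N : ℕ} (hN : (freyCurve (-(ℓ : ℤ)) ((ℓ - 1 : ℕ) : ℤ)).conductorNorm ℤ = N) {v c : ℕ}
    (hdeg : ∀ [NeZero (N / ℓ * ℓ)] (W : WeierstrassCurve ℚ) [W.IsElliptic]
      (P : ModularParametrizationData W (N / ℓ * ℓ)),
      (∀ n : ℕ, W.LFunction n = (freyCurve (-(ℓ : ℤ)) ((ℓ - 1 : ℕ) : ℤ)).LFunction n) →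
      (∀ (W' : WeierstrassCurve ℚ) [W'.IsElliptic] (P' : ModularParametrizationData W' (N / ℓ * ℓ)),
          P'.f = P.f → P.modularDegree ≤ P'.modularDegree) →
      2 ^ v * ordProj[2] ((W.minimalDiscriminantNorm ℤ).factorization ℓ) ≤
        2 ^ c * ordProj[2] P.modularDegree) :
    2 ^ v ≤ 2 ^ c * ordProj[2] (brandtXi (N / ℓ) ℓ
      (fun n => (freyCurve (-(ℓ : ℤ)) ((ℓ - 1 : ℕ) : ℤ)).LFunction n)) := by
  classical
  -- the Legendre point lies in the crux's domain with `Nm = ℓ` (as in p133187/p134266)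
  have hℓ1 : 1 ≤ ℓ := hℓ.one_lt.le
  have hM0 : ℓ - 1 ≠ 0 := by have := hℓ.two_le; omega
  have hℓ2 : ℓ ≠ 2 := by
    intro h
    rw [h] at h32
    norm_num at h32
  set a : ℤ := -(ℓ : ℤ) with ha
  set b : ℤ := ((ℓ - 1 : ℕ) : ℤ) with hb
  have hℓcast : (ℓ : ℤ) = ((ℓ - 1 : ℕ) : ℤ) + 1 := by
    rw [Nat.cast_sub hℓ1]; push_cast; ring
  have hab_sum : a + b = -1 := by rw [ha, hb, hℓcast]; ring
  have habc : a * b * (a + b) = ((ℓ * (ℓ - 1) : ℕ) : ℤ) := by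
    rw [hab_sum, ha, hb]; push_cast; ring
  have hPM0 : ℓ * (ℓ - 1) ≠ 0 := Nat.mul_ne_zero hℓ.ne_zero hM0
  have h0 : a * b * (a + b) ≠ 0 := by rw [habc]; exact_mod_cast hPM0
  have hab : IsCoprime a b := by
    rw [ha, hb, IsCoprime.neg_left_iff, Int.isCoprime_iff_gcd_eq_one, Int.gcd_natCast_natCast]
    exact (Nat.coprime_self_sub_right hℓ1).mpr (Nat.coprime_one_right ℓ)
  have ha4 : a ≡ -1 [ZMOD 4] := by
    have h4M : (4 : ℕ) ∣ ℓ - 1 := (show (4 : ℕ) ∣ 32 by norm_num).trans h32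
    have h4 : (4 : ℤ) ∣ b := by rw [hb]; exact_mod_cast h4M
    have : a = -1 - b := by rw [ha, hb, hℓcast]; ring
    rw [this]
    calc -1 - b ≡ -1 - 0 [ZMOD 4] := Int.ModEq.sub_left _ ((Int.modEq_zero_iff_dvd).mpr h4)
      _ = -1 := by ring
  have hb32 : (32 : ℤ) ∣ b := by rw [hb]; exact_mod_cast h32
  have hnatAbs : (a * b * (a + b)).natAbs = ℓ * (ℓ - 1) := by rw [habc, Int.natAbs_natCast]
  haveI : (freyCurve a b).IsElliptic := isElliptic_freyCurve h0
  have hNval : N = UniqueFactorizationMonoid.radical (ℓ * (ℓ - 1)) := by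
    rw [← hN, conductorNorm_freyCurve_serre hab h0 ha4 hb32, hnatAbs]
  have hNpos : 0 < N := by rw [hNval]; exact Nat.radical_pos _
  have hNsq : Squarefree N := by rw [hNval]; exact UniqueFactorizationMonoid.squarefree_radical
  have hℓN : ℓ ∣ N := by
    rw [hNval]
    refine Nat.dvd_of_mem_primeFactors ?_
    rw [Nat.primeFactors_radical, Nat.primeFactors_mul hℓ.ne_zero hM0, hℓ.primeFactors]
    simp
  have hodd : Odd ℓ := hℓ.odd_of_ne_two hℓ2
  have hcard : Odd ℓ.primeFactors.card := by rw [hℓ.primeFactors]; simp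
  -- the level `N / ℓ · ℓ = N`
  have hL : N / ℓ * ℓ = N := Nat.div_mul_cancel hℓN
  haveI hneL : NeZero (N / ℓ * ℓ) := ⟨by rw [hL]; exact hNpos.ne'⟩
  have hN' : (freyCurve a b).conductorNorm ℤ = N / ℓ * ℓ := by rw [hL]; exact hN
  have hsqL : Squarefree (N / ℓ * ℓ) := by rw [hL]; exact hNsq
  -- a datum of `E` at level `N / ℓ · ℓ` (modularity) and a degree-minimal datum in its newform class
  obtain ⟨P₀⟩ := hMod a b hab h0 (N / ℓ * ℓ) hN'
  have hex : ∃ d : ℕ, ∃ (W : WeierstrassCurve ℚ) (_ : W.IsElliptic)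
      (P : ModularParametrizationData W (N / ℓ * ℓ)), P.f = P₀.f ∧ P.modularDegree = d :=
    ⟨_, freyCurve a b, inferInstance, P₀, rfl, rfl⟩
  obtain ⟨W, hW, P, hPf, hPd⟩ := Nat.find_spec hex
  haveI := hW
  have hmin : ∀ (W' : WeierstrassCurve ℚ) [W'.IsElliptic]
      (P' : ModularParametrizationData W' (N / ℓ * ℓ)), P'.f = P.f →
        P.modularDegree ≤ P'.modularDegree := by
    intro W' _ P' hf'
    rw [hPd]
    exact Nat.find_min' hex ⟨W', inferInstance, P', hf'.trans hPf, rfl⟩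
  -- `W` has the `a`-sequence of `E` …
  have hLfun : ∀ n : ℕ, W.LFunction n = (freyCurve a b).LFunction n := fun n => by
    have h1 := P.isNewformOf.2 n
    have h2 := P₀.isNewformOf.2 n
    rw [hPf] at h1
    rw [h1] at h2
    exact_mod_cast h2
  have hfun : (fun n => W.LFunction n) = fun n => (freyCurve a b).LFunction n := funext hLfun
  -- … and conductor `N` (Carayol at the squarefree level `N`)
  have hWN : W.conductorNorm ℤ = N / ℓ * ℓ :=
    (P.isNewformOf.level_eq_conductorNorm_of_squarefree_level hsqL).symm
  -- a Brandt setup of type `(N/ℓ, ℓ)` exists and computes `brandtXi`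
  have hne := Summit.ABC.ABC.Theorems.XiBound.Negative.nonempty_xiSetup_freyCurve
    hab h0 hodd hℓ.squarefree hcard (by rw [hN]; exact hℓN)
  rw [hN] at hne
  obtain ⟨S⟩ := hne
  rw [S.brandtXi_eq_xi]
  -- Takahashi's transfer at `(W, P, S)` and the degree bound
  have hpt := ordProj_modularDegree_le_of_takahashi hT 2 W (N / ℓ) ℓ hℓ hsqL hWN P hmin S
  rw [hfun] at hpt
  have hlaw := hdeg W P hLfun hmin
  set C : ℕ := ordProj[2] ((W.minimalDiscriminantNorm ℤ).factorization ℓ) with hC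
  have hCpos : 0 < C := Nat.ordProj_pos _ _
  have hchain : 2 ^ v * C ≤
      2 ^ c * ordProj[2] (S.xi fun n => (freyCurve a b).LFunction n) * C :=
    calc 2 ^ v * C ≤ 2 ^ c * ordProj[2] P.modularDegree := hlaw
      _ ≤ 2 ^ c * (C * ordProj[2] (S.xi fun n => (freyCurve a b).LFunction n)) :=
          Nat.mul_le_mul_left _ hpt
      _ = 2 ^ c * ordProj[2] (S.xi fun n => (freyCurve a b).LFunction n) * C := by ring
  exact Nat.le_of_mul_le_mul_right hchain hCpos

/-! ## The hypotheses on the degree side -/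

/-- **Hypothesis `ForcedPairDegreeDepthLaw` — the forced-pair 2-adic depth law for OPTIMAL MODULAR DEGREES
(census-backed, NOT proved, NOT in print).**  There is `c` such that for all primes `q ≠ 2` and `ℓ` with
`32 q ∣ ℓ − 1` (the pair `(q, ℓ)` is FORCED: `ℓ ≡ 1 (mod q)`), `E = E_(−ℓ, ℓ−1)` of conductor `N`
(`= rad(ℓ(ℓ−1))`), every elliptic `W/ℚ` with `aₙ(W) = aₙ(E)` for all `n` and every datum `P` of `W` at level `N`
that is degree-minimal among all data with the same newform (i.e. `W` is the strong Weil curve of the class and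
`δ(P)` its optimal degree): `2^{v₂(q−1)} · ordProj[2] c_ℓ(W) ≤ 2^c · ordProj[2] δ(P)`, `c_ℓ(W) = ord_ℓ Δ_min(W)` —
i.e. `v₂(δ_opt) − v₂(c_ℓ(W_opt)) ≥ v₂(q−1) − c`.  Candidate mechanism: Mazur's level-`q` 2-Eisenstein tower (index
`num((q−1)/12) ∋ 2^{v₂(q−1)−2}`) is visible in the modular degree of the Frey curve of the triple `1 + (ℓ−1) = ℓ`
(Watkins-type 2-divisibility of `deg φ` from congruences of `f_E` with Eisenstein-congruent forms).  Census (PARI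
`ellmoddegree` over isogeny classes; class-min `v₂ deg` minus class-max `v₂ c_ℓ` is a rigorous lower bound for the
left side): forced levels `q = 17, 97, 193` ↦ class-min `v₂ deg = 5, 8, 7` against the control `(16,81,97) ↦ 2`
(kit j019358/j019359/j019456); in-scope rows `(q, ℓ) = (17, 5441)`: class `[14, 16]`, `(97, 4657)`: class `[8, 10]`
(kit j019719).  It implies the Brandt-side `ForcedPairDepthLaw` (`forcedPairDepthLaw_of_degreeDepthLaw`).
HYPOTHESIS of this negative lemma (filed `--negative-modulo ForcedPairDegreeDepthLaw`); not a Literature fact. -/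
def ForcedPairDegreeDepthLaw : Prop :=
  ∃ c : ℕ, ∀ q ℓ : ℕ, q.Prime → ℓ.Prime → q ≠ 2 → 32 * q ∣ ℓ - 1 →
    ∀ (N : ℕ) [NeZero N], (freyCurve (-(ℓ : ℤ)) ((ℓ - 1 : ℕ) : ℤ)).conductorNorm ℤ = N →
    ∀ (W : WeierstrassCurve ℚ) [W.IsElliptic] (P : ModularParametrizationData W N),
      (∀ n : ℕ, W.LFunction n = (freyCurve (-(ℓ : ℤ)) ((ℓ - 1 : ℕ) : ℤ)).LFunction n) →
      (∀ (W' : WeierstrassCurve ℚ) [W'.IsElliptic] (P' : ModularParametrizationData W' N),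
          P'.f = P.f → P.modularDegree ≤ P'.modularDegree) →
      2 ^ ((q - 1).factorization 2) * ordProj[2] ((W.minimalDiscriminantNorm ℤ).factorization ℓ) ≤
        2 ^ c * ordProj[2] P.modularDegree

/-- **Hypothesis `ProthDegreeDepthFamily` — the degree-side twin of `ProthDepthFamily` (p107816): a 2-adic depth law
for optimal modular degrees along SOME polynomially sparse Proth family (census-backed, NOT proved).**  There are
`c, A` such that for arbitrarily large `s` some prime `p ≡ 1 (mod 2^s)` with `p ≤ 2^{A s}` has, for `E = E_(−p, p−1)`
of conductor `N`, every elliptic `W/ℚ` with the `a`-sequence of `E` and every newform-minimal datum `P` of `W` at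
level `N`: `2^s · ordProj[2] c_p(W) ≤ 2^c · ordProj[2] δ(P)`.  Along the least primes `p_s ≡ 1 (mod 2^s)` and the
deep-`m₂` Proth primes this is what the degree censuses measured (kit j016666: `v₂ deg ≥ s − 1` on 11/11 rows to
`s = 16`; j017919: `v₂ deg(E_(−p,p−1)) = 11, 15, 15, 12, 15` at `p = 12289, 18433, 65537, 40961, 147457`; j020843: 8/8
out-of-sample rows); the UNIFORM law in `s` is census-false (`p = 786433`: depth 9), the family form is what both
surviving crux lines (`forced-pair-dlog`, `eta2-residuacity-depth`) construct.  It implies `ProthDepthFamily`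
(`prothDepthFamily_of_degreeDepthFamily`).  HYPOTHESIS; not a Literature fact. -/
def ProthDegreeDepthFamily : Prop :=
  ∃ c A : ℕ, ∀ s₀ : ℕ, ∃ s p : ℕ, s₀ ≤ s ∧ p.Prime ∧ 2 ^ s ∣ p - 1 ∧ p ≤ 2 ^ (A * s) ∧
    ∀ (N : ℕ) [NeZero N], (freyCurve (-(p : ℤ)) ((p - 1 : ℕ) : ℤ)).conductorNorm ℤ = N →
    ∀ (W : WeierstrassCurve ℚ) [W.IsElliptic] (P : ModularParametrizationData W N),
      (∀ n : ℕ, W.LFunction n = (freyCurve (-(p : ℤ)) ((p - 1 : ℕ) : ℤ)).LFunction n) →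
      (∀ (W' : WeierstrassCurve ℚ) [W'.IsElliptic] (P' : ModularParametrizationData W' N),
          P'.f = P.f → P.modularDegree ≤ P'.modularDegree) →
      2 ^ s * ordProj[2] ((W.minimalDiscriminantNorm ℤ).factorization p) ≤
        2 ^ c * ordProj[2] P.modularDegree

/-! ## Degree laws ⟹ Brandt laws ⟹ `¬ EisensteinQuarantine` -/

/-- At a Legendre point `(a, b) = (−ℓ, ℓ−1)` with `ℓ` prime and `32 ∣ ℓ − 1` the quarantined prime divides the
conductor: `N = rad(ℓ(ℓ−1))` by the tree's Serre normalisation `conductorNorm_freyCurve_serre`. [folklore] -/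
theorem dvd_conductorNorm_of_legendrePoint {ℓ N : ℕ} (hℓ : ℓ.Prime) (h32 : 32 ∣ ℓ - 1)
    (hN : (freyCurve (-(ℓ : ℤ)) ((ℓ - 1 : ℕ) : ℤ)).conductorNorm ℤ = N) : ℓ ∣ N := by
  have hℓ1 : 1 ≤ ℓ := hℓ.one_lt.le
  have hM0 : ℓ - 1 ≠ 0 := by have := hℓ.two_le; omega
  have hℓcast : (ℓ : ℤ) = ((ℓ - 1 : ℕ) : ℤ) + 1 := by
    rw [Nat.cast_sub hℓ1]; push_cast; ring
  have hsum : -(ℓ : ℤ) + ((ℓ - 1 : ℕ) : ℤ) = -1 := by rw [hℓcast]; ring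
  have habc : (-(ℓ : ℤ)) * ((ℓ - 1 : ℕ) : ℤ) * (-(ℓ : ℤ) + ((ℓ - 1 : ℕ) : ℤ)) =
      ((ℓ * (ℓ - 1) : ℕ) : ℤ) := by
    rw [hsum]; push_cast; ring
  have hPM0 : ℓ * (ℓ - 1) ≠ 0 := Nat.mul_ne_zero hℓ.ne_zero hM0
  have h0 : (-(ℓ : ℤ)) * ((ℓ - 1 : ℕ) : ℤ) * (-(ℓ : ℤ) + ((ℓ - 1 : ℕ) : ℤ)) ≠ 0 := by
    rw [habc]; exact_mod_cast hPM0
  have hab : IsCoprime (-(ℓ : ℤ)) ((ℓ - 1 : ℕ) : ℤ) := by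
    rw [IsCoprime.neg_left_iff, Int.isCoprime_iff_gcd_eq_one, Int.gcd_natCast_natCast]
    exact (Nat.coprime_self_sub_right hℓ1).mpr (Nat.coprime_one_right ℓ)
  have ha4 : (-(ℓ : ℤ)) ≡ -1 [ZMOD 4] := by
    have h4M : (4 : ℕ) ∣ ℓ - 1 := (show (4 : ℕ) ∣ 32 by norm_num).trans h32
    have h4 : (4 : ℤ) ∣ ((ℓ - 1 : ℕ) : ℤ) := by exact_mod_cast h4M
    have : (-(ℓ : ℤ)) = -1 - ((ℓ - 1 : ℕ) : ℤ) := by rw [hℓcast]; ring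
    rw [this]
    calc -1 - ((ℓ - 1 : ℕ) : ℤ) ≡ -1 - 0 [ZMOD 4] :=
          Int.ModEq.sub_left _ ((Int.modEq_zero_iff_dvd).mpr h4)
      _ = -1 := by ring
  have hb32 : (32 : ℤ) ∣ ((ℓ - 1 : ℕ) : ℤ) := by exact_mod_cast h32
  haveI : (freyCurve (-(ℓ : ℤ)) ((ℓ - 1 : ℕ) : ℤ)).IsElliptic := isElliptic_freyCurve h0
  have hNval : N = UniqueFactorizationMonoid.radical (ℓ * (ℓ - 1)) := by
    rw [← hN, conductorNorm_freyCurve_serre hab h0 ha4 hb32, habc, Int.natAbs_natCast]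
  rw [hNval]
  refine Nat.dvd_of_mem_primeFactors ?_
  rw [Nat.primeFactors_radical, Nat.primeFactors_mul hℓ.ne_zero hM0, hℓ.primeFactors]
  simp

/-- **`ForcedPairDegreeDepthLaw` ⟹ `ForcedPairDepthLaw`** (same constant `c`), by
`pow_le_ordProj_brandtXi_of_degreeBound` at every forced pair (`32 ∣ 32 q ∣ ℓ − 1`), the law being applied at the
level `N / ℓ · ℓ = N`. [cite: Takahashi2001, Thm. 2.3 (p. 79)] -/
theorem forcedPairDepthLaw_of_degreeDepthLaw (hT : takahashi2001_thm_2_3)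
    (hMod : Summit.ABC.ABC.Theses.DefiniteXi.FreyModularity) (hD : ForcedPairDegreeDepthLaw) :
    ForcedPairDepthLaw := by
  obtain ⟨c, hc⟩ := hD
  refine ⟨c, fun q ℓ hq hℓ hq2 h32 N hN => ?_⟩
  have h32' : 32 ∣ ℓ - 1 := (Dvd.intro q rfl).trans h32
  have hN' : (freyCurve (-(ℓ : ℤ)) ((ℓ - 1 : ℕ) : ℤ)).conductorNorm ℤ = N / ℓ * ℓ := by
    rw [Nat.div_mul_cancel (dvd_conductorNorm_of_legendrePoint hℓ h32' hN)]; exact hN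
  refine pow_le_ordProj_brandtXi_of_degreeBound hT hMod hℓ h32' hN ?_
  intro _ W _ P hLf hmin
  exact hc q ℓ hq hℓ hq2 h32 (N / ℓ * ℓ) hN' W P hLf hmin

/-- **`ProthDegreeDepthFamily` ⟹ `ProthDepthFamily`** (same `c`, `A`; the family is taken with `s ≥ 5` so that
`32 ∣ p − 1`), by `pow_le_ordProj_brandtXi_of_degreeBound`. [cite: Takahashi2001, Thm. 2.3 (p. 79)] -/
theorem prothDepthFamily_of_degreeDepthFamily (hT : takahashi2001_thm_2_3)
    (hMod : Summit.ABC.ABC.Theses.DefiniteXi.FreyModularity) (hD : ProthDegreeDepthFamily) :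
    ProthDepthFamily := by
  obtain ⟨c, A, hcA⟩ := hD
  refine ⟨c, A, fun s₀ => ?_⟩
  obtain ⟨s, p, hs, hp, hsp, hpA, hdeg⟩ := hcA (max s₀ 5)
  have hs5 : 5 ≤ s := le_of_max_le_right hs
  have h32 : 32 ∣ p - 1 := by
    rw [show (32 : ℕ) = 2 ^ 5 by norm_num]
    exact (Nat.pow_dvd_pow 2 hs5).trans hsp
  refine ⟨s, p, le_of_max_le_left hs, hp, hsp, hpA, fun N hN => ?_⟩
  have hN' : (freyCurve (-(p : ℤ)) ((p - 1 : ℕ) : ℤ)).conductorNorm ℤ = N / p * p := by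
    rw [Nat.div_mul_cancel (dvd_conductorNorm_of_legendrePoint hp h32 hN)]; exact hN
  refine pow_le_ordProj_brandtXi_of_degreeBound hT hMod hp h32 hN ?_
  intro _ W _ P hLf hmin
  exact hdeg (N / p * p) hN' W P hLf hmin

/-- **`EisensteinQuarantine` is false under Takahashi's Thm. 2.3, modularity of Frey curves and the forced-pair
DEGREE depth law.**  `ForcedPairDegreeDepthLaw ⟹ ForcedPairDepthLaw` (`forcedPairDepthLaw_of_degreeDepthLaw`) and
the landed `EisensteinQuarantine_false_of_ForcedPairDepthLaw` (p134266: unconditional two-prime 2-power supply p132885,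
then p107816 at `ε = 1/(4A)`).  Three displayed inputs: a named fact TRUE in print, a route item TRUE in print, and
an LMFDB/PARI-checkable statement about optimal modular degrees of the Frey curves of the triples `1 + (ℓ−1) = ℓ`.
[cite: Takahashi2001, Thm. 2.3 (p. 79)] -/
theorem EisensteinQuarantine_false_of_ForcedPairDegreeDepthLaw (hT : takahashi2001_thm_2_3)
    (hMod : Summit.ABC.ABC.Theses.DefiniteXi.FreyModularity) (hD : ForcedPairDegreeDepthLaw) :
    ¬ Summit.ABC.ABC.Theses.DefiniteXi.EisensteinQuarantine :=
  EisensteinQuarantine_false_of_ForcedPairDepthLaw (forcedPairDepthLaw_of_degreeDepthLaw hT hMod hD)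

/-- **`EisensteinQuarantine` is false under Takahashi's Thm. 2.3, modularity of Frey curves and a degree depth law
along some polynomially sparse Proth family** (`prothDepthFamily_of_degreeDepthFamily` and the landed
`EisensteinQuarantine_false_of_ProthDepthFamily`, p107816).  This is the form reached by BOTH surviving crux lines:
`forced-pair-dlog` (forced partner `q`, `s = v₂(q−1)`, unconditional supply) and `eta2-residuacity-depth`
(`s = m₂(p)`, supply under ERH). [cite: Takahashi2001, Thm. 2.3 (p. 79)] -/
theorem EisensteinQuarantine_false_of_ProthDegreeDepthFamily (hT : takahashi2001_thm_2_3)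
    (hMod : Summit.ABC.ABC.Theses.DefiniteXi.FreyModularity) (hD : ProthDegreeDepthFamily) :
    ¬ Summit.ABC.ABC.Theses.DefiniteXi.EisensteinQuarantine :=
  EisensteinQuarantine_false_of_ProthDepthFamily (prothDepthFamily_of_degreeDepthFamily hT hMod hD)

end Summit.ABC.ABC.Theorems.EisensteinQuarantine.Negative

end
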